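import Mathlib.LinearAlgebra.Matrix.NonsingularInverse
import Mathlib.RingTheory.Localization.Away.Basic
import HarnessLib

/-!
# Cramer spread: a regular solution of a square subsystem solves the full linear system wherever it is consistent

Topic: `Literature/AlgebraicGeometry/Resolution`. Pure commutative/linear algebra behind «solve a pointwise-consistent
linear system with regular coefficients by Cramer's rule on the open set where a maximal minor is invertible». Let `A` be
a commutative ring, `M ∈ A^{s×t}`, `b ∈ A^s`, and `I : t → s` a choice of `t` rows (a maximal minor `M_I`). Over any
`A`-algebra `B` in which `Δ = det M_I` is a unit (e.g. `B = A[1/Δ]`, the coordinate ring of the basic open `D(Δ)`) put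
`c := M_I⁻¹ b_I ∈ B^t` (Cramer). PROVED:

* `Matrix.mulVec_eq_of_consistent_of_isUnit_det` — over a FIELD: if `M_I` is invertible, `M_I c = b_I`, and the full
  system `M x = b` is consistent, then `M c = b` (the solution of the subsystem is unique, and any solution of the full
  system solves the subsystem);
* `exists_cramerSpread` — over `B` as above there is `c ∈ B^t` with `M_I c = b_I` in `B`, such that for every ring
  homomorphism `φ : B → L` to a field (e.g. evaluation at a closed point of `D(Δ)`): if the reduced system
  `φ(M) x = φ(b)` is CONSISTENT over `L`, then `φ(c)` solves it. So ONE vector of regular functions on `D(Δ)` solves the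
  system at every point of `D(Δ)` where it is solvable at all.

Bearing (nothing of it asserted): step (ii) «purity correction `g′ = g − Σ_α c_α g^α` with `c_α ∈ O(V)` by Cramer on the
open set where a fixed maximal minor of the (regular, pointwise consistent, full-column-rank) system of non-pure Hasse
coefficients is invertible» of the discharge route for GAP-LEDGER row R20 (Th. 6.14 (1) of H. Hironaka's 2017 manuscript;
campaign `res-hironaka`, lead README §2 (ii)); the entries of that system are the global sections of
`HasseSchmidtChartPurity.lean`.

Sources: [Matsumura1987] §1–§4 (localisation `A[1/Δ]`; Thm. 2.1 area: `adj(M)·M = det(M)·1`, Cramer);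
[EGAIV4] §16.11 (where the Taylor coefficients entering such systems come from).
-/

noncomputable section

namespace Literature.AlgebraicGeometry.Resolution

open Matrix

universe u v w

/-! ## Over a field -/

section Field

variable {L : Type u} [Field L] {s t : Type*} [Fintype t] [DecidableEq t]

/-- **Uniqueness transfers a subsystem solution to the full system.** Over a field, let `M ∈ L^{s×t}`, `b ∈ L^s`,
`I : t → s` with `M_I := M.submatrix I id` invertible, and `c` with `M_I c = b_I`. If `M x = b` has SOME solution `x`,
then `M c = b` (indeed `x` solves the subsystem, whose solution is unique, so `x = c`). [cite: Matsumura1987, §2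
(Thm. 2.1 neighbourhood: `adj(M) M = det(M)·1`, Cramer's rule)] -/
theorem Matrix.mulVec_eq_of_consistent_of_isUnit_det (M : Matrix s t L) (b : s → L) (I : t → s)
    (hI : IsUnit (M.submatrix I id).det) (c : t → L) (hc : (M.submatrix I id) *ᵥ c = b ∘ I)
    (hcons : ∃ x : t → L, M *ᵥ x = b) : M *ᵥ c = b := by
  obtain ⟨x, hx⟩ := hcons
  -- `x` solves the subsystem
  have hxI : (M.submatrix I id) *ᵥ x = b ∘ I := by
    ext i
    have := congrFun hx (I i)
    simpa [Matrix.mulVec, dotProduct, Matrix.submatrix_apply] using this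
  -- uniqueness for the invertible square subsystem
  have hxc : x = c := by
    have h1 : (M.submatrix I id)⁻¹ *ᵥ ((M.submatrix I id) *ᵥ x) = (M.submatrix I id)⁻¹ *ᵥ ((M.submatrix I id) *ᵥ c) := by
      rw [hxI, hc]
    rwa [Matrix.mulVec_mulVec, Matrix.mulVec_mulVec, Matrix.nonsing_inv_mul _ hI, Matrix.one_mulVec,
      Matrix.one_mulVec] at h1
  rw [← hxc, hx]

end Field

/-! ## Spreading a Cramer solution -/

section Spread

variable {A : Type u} [CommRing A] {s t : Type*} [Fintype t] [DecidableEq t]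

/-- **Cramer spread.** `M ∈ A^{s×t}`, `b ∈ A^s`, `I : t → s`, and an `A`-algebra `B` in which `Δ = det (M.submatrix I id)`
becomes a unit (e.g. `B = A[1/Δ] = Γ(D(Δ))`). Then there is `c ∈ B^t` with `M_I c = b_I` in `B` (Cramer:
`c = M_I⁻¹ b_I`) such that for every ring homomorphism `φ : B → L` into a field — evaluation at a point of `D(Δ)` —
CONSISTENCY of the reduced full system (`∃ x, φ(M) x = φ(b)`) implies that `φ(c)` SOLVES it: `φ(M) φ(c) = φ(b)`. One
vector of regular functions solves the system at every point where it is solvable. [cite: Matsumura1987, §4 (localisation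
at an element) and §2 (Cramer / adjugate identity)] -/
theorem exists_cramerSpread (M : Matrix s t A) (b : s → A) (I : t → s) (B : Type v) [CommRing B] [Algebra A B]
    (hΔ : IsUnit (algebraMap A B (M.submatrix I id).det)) :
    ∃ c : t → B,
      (M.submatrix I id).map (algebraMap A B) *ᵥ c = algebraMap A B ∘ b ∘ I ∧
      ∀ (L : Type w) [Field L] (φ : B →+* L),
        (∃ x : t → L, M.map (φ.comp (algebraMap A B)) *ᵥ x = φ ∘ algebraMap A B ∘ b) →
          M.map (φ.comp (algebraMap A B)) *ᵥ (φ ∘ c) = φ ∘ algebraMap A B ∘ b := by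
  set MI : Matrix t t B := (M.submatrix I id).map (algebraMap A B) with hMI
  have hMIdet : IsUnit MI.det := by
    rw [hMI, ← RingHom.mapMatrix_apply, ← RingHom.map_det]
    exact hΔ
  set c : t → B := MI⁻¹ *ᵥ (algebraMap A B ∘ b ∘ I) with hc
  have hsol : MI *ᵥ c = algebraMap A B ∘ b ∘ I := by
    rw [hc, Matrix.mulVec_mulVec, Matrix.mul_nonsing_inv _ hMIdet, Matrix.one_mulVec]
  refine ⟨c, hsol, fun L _ φ hcons => ?_⟩
  -- reduce everything along `φ`
  have hsub : (M.map (φ.comp (algebraMap A B))).submatrix I id = MI.map φ := by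
    rw [hMI]
    ext i j
    simp [Matrix.submatrix_apply, Matrix.map_apply]
  have hIunit : IsUnit ((M.map (φ.comp (algebraMap A B))).submatrix I id).det := by
    rw [hsub, ← RingHom.mapMatrix_apply, ← RingHom.map_det]
    exact hMIdet.map φ
  have hcφ : ((M.map (φ.comp (algebraMap A B))).submatrix I id) *ᵥ (φ ∘ c) = (φ ∘ algebraMap A B ∘ b) ∘ I := by
    rw [hsub]
    funext i
    rw [← RingHom.map_mulVec, hsol]
    rfl
  exact Matrix.mulVec_eq_of_consistent_of_isUnit_det _ _ I hIunit (φ ∘ c) hcφ hcons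

/-- **Cramer spread on the basic open `D(Δ)`**: the instance `B = A[1/Δ]` (`Localization.Away Δ`) of
`exists_cramerSpread`. [cite: Matsumura1987, §4 (localisation at an element)] -/
theorem exists_cramerSpread_away (M : Matrix s t A) (b : s → A) (I : t → s) :
    ∃ c : t → Localization.Away (M.submatrix I id).det,
      (M.submatrix I id).map (algebraMap A _) *ᵥ c = algebraMap A _ ∘ b ∘ I ∧
      ∀ (L : Type w) [Field L] (φ : Localization.Away (M.submatrix I id).det →+* L),
        (∃ x : t → L, M.map (φ.comp (algebraMap A _)) *ᵥ x = φ ∘ algebraMap A _ ∘ b) →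
          M.map (φ.comp (algebraMap A _)) *ᵥ (φ ∘ c) = φ ∘ algebraMap A _ ∘ b :=
  exists_cramerSpread M b I _ (IsLocalization.Away.algebraMap_isUnit (M.submatrix I id).det)

end Spread

end Literature.AlgebraicGeometry.Resolution

end
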